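import Summits.QuantumFields.YangMills.Theorems.FradkinShenkerFlowStrongPinningPoincareHeatBath
import HarnessLib

/-!
# Robust ball (Y2) — variance tools for the Langevin / Glauber Poincaré files: bias–variance splitting and the Holley–Stroock transfer of a
# Poincaré-type bound to a boundedly re-weighted measure

HONEST FRAMING: venture file of the cell `pub-ymgap` (QuantumFields programme), track ROBUST-BALL, seat rb-p2 (g13).  Pure measure theory (no lattice
object): the three elementary variance facts used by `LangevinPoincareBall.lean`, `LangevinPoincareZd.lean` and their ball / kernel companions, isolated so
that those files depend on BUILT parents only.
* `variance_le_integral_sq_sub` — the variance is the least mean-square deviation from a constant: `Var_μ(X) ≤ ∫ (X − a)² dμ`.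
* `integral_sq_sub_eq_sq_add_variance` — `∫ (a − ψ)² dν = (a − ∫ψ dν)² + ∫ (ψ − ∫ψ dν)² dν` (bias² + variance).
* `variance_tilted_le_of_osc` — HOLLEY–STROOCK for Poincaré-type bounds: if `K·Var_ν(ψ) ≤ ∫ G dν` (`G ≥ 0`) and `h` is a bounded measurable re-weighting
  with `h(a) − h(b) ≤ δ`, then `K·Var_{ν.tilted h}(ψ) ≤ e^{δ} ∫ G d(ν.tilted h)` (the density `e^{h}/Z` lies between `e^{inf h}/Z` and `e^{sup h}/Z`;
  R. Holley, D. Stroock, J. Stat. Phys. 46 (1987) 1159, the variance case).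
0 sorry, 0 definitions.  Everything here is proved. [folklore]
-/

noncomputable section

open MeasureTheory Function Real Finset ProbabilityTheory
open Summit.QuantumFields.YangMills.Theorems.StrongPinningPoincare

namespace Summit.Ventures.YMGap.RobustBall.LangevinPoincare

/-! ### Holley–Stroock: a Poincaré-type bound survives a bounded re-weighting with the factor `e^{osc}` -/

section HolleyStroock

variable {Ω : Type*} [MeasurableSpace Ω]

/-- The variance is the least mean-square deviation from a constant: `Var_μ(X) ≤ ∫ (X − a)² dμ`. [folklore] -/
theorem variance_le_integral_sq_sub (μ : Measure Ω) [IsProbabilityMeasure μ] {X : Ω → ℝ} (hXm : Measurable X) {M : ℝ}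
    (hXb : ∀ x, |X x| ≤ M) (a : ℝ) : Var[X; μ] ≤ ∫ x, (X x - a) ^ 2 ∂μ := by
  have hXi : Integrable X μ := HeatBath.integrable_of_abs_le hXm hXb
  set m : ℝ := ∫ x, X x ∂μ with hm
  have h2 : Integrable (fun x => (X x - m) ^ 2) μ := by
    refine HeatBath.integrable_of_abs_le ((hXm.sub measurable_const).pow_const 2) (C := (M + |m|) ^ 2) fun x => ?_
    rw [abs_pow]
    exact pow_le_pow_left₀ (abs_nonneg _) ((abs_sub _ _).trans (add_le_add (hXb x) le_rfl)) 2
  have hlin : Integrable (fun x => 2 * (m - a) * (X x - m) + (m - a) ^ 2) μ := ((hXi.sub (integrable_const m)).const_mul _).add (integrable_const _)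
  have e1 : (fun x => (X x - a) ^ 2) = fun x => (X x - m) ^ 2 + (2 * (m - a) * (X x - m) + (m - a) ^ 2) := by funext x; ring
  rw [variance_eq_integral hXm.aemeasurable, e1, integral_add h2 hlin,
    integral_add (f := fun x => 2 * (m - a) * (X x - m)) (g := fun _ => (m - a) ^ 2) ((hXi.sub (integrable_const m)).const_mul _) (integrable_const _),
    integral_const_mul, integral_sub hXi (integrable_const m)]
  simp only [integral_const, probReal_univ, smul_eq_mul, one_mul, ← hm, sub_self, mul_zero, zero_add]
  nlinarith [sq_nonneg (m - a)]

/-- **Holley–Stroock for Poincaré-type bounds**: if `K · Var_ν(ψ) ≤ ∫ G dν` for a probability measure `ν`, `G ≥ 0`, and `h` is a bounded measurable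
re-weighting with oscillation `h(a) − h(b) ≤ δ`, then `K · Var_{ν.tilted h}(ψ) ≤ e^{δ} ∫ G d(ν.tilted h)` (the density `e^{h}/Z` lies between `e^{inf h}/Z`
and `e^{sup h}/Z`). [folklore] -/
theorem variance_tilted_le_of_osc (ν : Measure Ω) [IsProbabilityMeasure ν] {h : Ω → ℝ} (hm : Measurable h) {Bh : ℝ} (hb : ∀ x, |h x| ≤ Bh)
    {δ : ℝ} (hosc : ∀ a b, h a - h b ≤ δ) {ψ : Ω → ℝ} (hψm : Measurable ψ) {Mψ : ℝ} (hψb : ∀ x, |ψ x| ≤ Mψ)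
    {G : Ω → ℝ} (hGm : Measurable G) (hG0 : ∀ x, 0 ≤ G x) {MG : ℝ} (hGb : ∀ x, |G x| ≤ MG) {K : ℝ} (hK : 0 ≤ K)
    (hP : K * Var[ψ; ν] ≤ ∫ x, G x ∂ν) :
    K * Var[ψ; ν.tilted h] ≤ Real.exp δ * ∫ x, G x ∂(ν.tilted h) := by
  haveI : Nonempty Ω := by
    by_contra hΩ
    rw [not_nonempty_iff] at hΩ
    have h1 := IsProbabilityMeasure.measure_univ (μ := ν)
    rw [Set.univ_eq_empty_iff.mpr hΩ, measure_empty] at h1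
    exact zero_ne_one h1
  -- sup and inf of the re-weighting
  have hbdd : BddAbove (Set.range h) := ⟨Bh, by rintro _ ⟨x, rfl⟩; exact (abs_le.1 (hb x)).2⟩
  have hbdd' : BddBelow (Set.range h) := ⟨-Bh, by rintro _ ⟨x, rfl⟩; exact (abs_le.1 (hb x)).1⟩
  set S : ℝ := ⨆ x, h x with hSdef
  set I : ℝ := ⨅ x, h x with hIdef
  have hS : ∀ x, h x ≤ S := fun x => le_ciSup hbdd x
  have hI : ∀ x, I ≤ h x := fun x => ciInf_le hbdd' x
  have hSI : S - I ≤ δ := by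
    have h1 : ∀ x, h x ≤ I + δ := fun x => by
      have := le_ciInf (f := h) fun y => show h x - δ ≤ h y by linarith [hosc x y]
      linarith
    linarith [ciSup_le h1]
  -- the tilted measure
  have hexpi : Integrable (fun x => Real.exp (h x)) ν := by
    refine Integrable.of_bound hm.exp.aestronglyMeasurable (Real.exp Bh) (ae_of_all _ fun x => ?_)
    rw [Real.norm_eq_abs, abs_exp]; exact Real.exp_le_exp.2 (abs_le.1 (hb x)).2
  set Z : ℝ := ∫ x, Real.exp (h x) ∂ν with hZ
  have hZpos : 0 < Z := integral_exp_pos hexpi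
  haveI : IsProbabilityMeasure (ν.tilted h) := isProbabilityMeasure_tilted hexpi
  set m : ℝ := ∫ x, ψ x ∂ν with hmdef
  -- `K Var_{ν'}(ψ) ≤ K ∫ (ψ − m)² dν' ≤ (e^{S}/Z) K Var_ν(ψ)`
  have hdev2m : Measurable fun x => (ψ x - m) ^ 2 := (hψm.sub measurable_const).pow_const 2
  have hdev2b : ∀ x, |(ψ x - m) ^ 2| ≤ (Mψ + |m|) ^ 2 := fun x => by
    rw [abs_pow]; exact pow_le_pow_left₀ (abs_nonneg _) ((abs_sub _ _).trans (add_le_add (hψb x) le_rfl)) 2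
  have h1 : Var[ψ; ν.tilted h] ≤ ∫ x, (ψ x - m) ^ 2 ∂(ν.tilted h) := variance_le_integral_sq_sub _ hψm hψb m
  have h2 : ∫ x, (ψ x - m) ^ 2 ∂(ν.tilted h) ≤ Real.exp S / Z * ∫ x, (ψ x - m) ^ 2 ∂ν := by
    rw [integral_tilted, ← integral_const_mul]
    simp_rw [smul_eq_mul]
    refine integral_mono_of_nonneg (ae_of_all _ fun x => mul_nonneg (div_nonneg (Real.exp_pos _).le hZpos.le) (sq_nonneg _))
      ((HeatBath.integrable_of_abs_le hdev2m hdev2b).const_mul _) (ae_of_all _ fun x => ?_)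
    exact mul_le_mul_of_nonneg_right (div_le_div_of_nonneg_right (Real.exp_le_exp.2 (hS x)) hZpos.le) (sq_nonneg _)
  have hvar : Var[ψ; ν] = ∫ x, (ψ x - m) ^ 2 ∂ν := by rw [variance_eq_integral hψm.aemeasurable]
  -- `∫ G dν ≤ e^{−I} Z ∫ G dν'`
  have hwG : Integrable (fun x => Real.exp (h x) / Z * G x) ν := by
    refine HeatBath.integrable_of_abs_le ((hm.exp.div_const Z).mul hGm) (C := Real.exp Bh / Z * MG) fun x => ?_
    rw [abs_mul, abs_div, abs_exp, abs_of_pos hZpos]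
    exact mul_le_mul (div_le_div_of_nonneg_right (Real.exp_le_exp.2 (abs_le.1 (hb x)).2) hZpos.le) (hGb x) (abs_nonneg _)
      (div_nonneg (Real.exp_pos _).le hZpos.le)
  have h3 : ∫ x, G x ∂ν ≤ Real.exp (-I) * Z * ∫ x, G x ∂(ν.tilted h) := by
    rw [integral_tilted, ← integral_const_mul]
    simp_rw [smul_eq_mul]
    refine integral_mono_of_nonneg (ae_of_all _ hG0) (hwG.const_mul _) (ae_of_all _ fun x => ?_)
    have e : Real.exp (-I) * Z * (Real.exp (h x) / Z * G x) = Real.exp (h x - I) * G x := by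
      rw [Real.exp_sub, Real.exp_neg]; field_simp
    show G x ≤ Real.exp (-I) * Z * (Real.exp (h x) / Z * G x)
    rw [e]
    exact le_mul_of_one_le_left (hG0 x) (Real.one_le_exp_iff.2 (sub_nonneg.2 (hI x)))
  have hG'0 : 0 ≤ ∫ x, G x ∂(ν.tilted h) := integral_nonneg hG0
  have hSZ : 0 ≤ Real.exp S / Z := div_nonneg (Real.exp_pos _).le hZpos.le
  calc K * Var[ψ; ν.tilted h] ≤ K * (Real.exp S / Z * ∫ x, (ψ x - m) ^ 2 ∂ν) := mul_le_mul_of_nonneg_left (h1.trans h2) hK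
    _ = Real.exp S / Z * (K * Var[ψ; ν]) := by rw [hvar]; ring
    _ ≤ Real.exp S / Z * (Real.exp (-I) * Z * ∫ x, G x ∂(ν.tilted h)) := mul_le_mul_of_nonneg_left (hP.trans h3) hSZ
    _ = Real.exp (S - I) * ∫ x, G x ∂(ν.tilted h) := by rw [Real.exp_sub, Real.exp_neg]; field_simp
    _ ≤ Real.exp δ * ∫ x, G x ∂(ν.tilted h) := mul_le_mul_of_nonneg_right (Real.exp_le_exp.2 hSI) hG'0

/-- **Mean square deviation from a constant = squared bias + variance**: for a probability measure `ν` and bounded measurable `ψ`,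
`∫ (a − ψ)² dν = (a − ∫ψ dν)² + ∫ (ψ − ∫ψ dν)² dν`. [folklore] -/
theorem integral_sq_sub_eq_sq_add_variance {Ω : Type*} [MeasurableSpace Ω] (ν : Measure Ω) [IsProbabilityMeasure ν] {ψ : Ω → ℝ}
    (hψm : Measurable ψ) {M : ℝ} (hψb : ∀ x, |ψ x| ≤ M) (a : ℝ) :
    ∫ x, (a - ψ x) ^ 2 ∂ν = (a - ∫ x, ψ x ∂ν) ^ 2 + ∫ x, (ψ x - ∫ y, ψ y ∂ν) ^ 2 ∂ν := by
  set m : ℝ := ∫ x, ψ x ∂ν with hm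
  have hψi : Integrable ψ ν := HeatBath.integrable_of_abs_le hψm hψb
  have h2 : Integrable (fun x => (ψ x - m) ^ 2) ν := by
    refine HeatBath.integrable_of_abs_le ((hψm.sub measurable_const).pow_const 2) (C := (M + |m|) ^ 2) fun x => ?_
    rw [abs_pow]
    exact pow_le_pow_left₀ (abs_nonneg _) ((abs_sub _ _).trans (add_le_add (hψb x) le_rfl)) 2
  have hlin : Integrable (fun x => 2 * (a - m) * (m - ψ x)) ν := ((integrable_const m).sub hψi).const_mul _
  have hI3 : Integrable (fun x => (a - m) ^ 2 + 2 * (a - m) * (m - ψ x)) ν := (integrable_const _).add hlin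
  have e1 : (fun x => (a - ψ x) ^ 2) = fun x => ((a - m) ^ 2 + 2 * (a - m) * (m - ψ x)) + (ψ x - m) ^ 2 := by
    funext x; ring
  rw [e1, integral_add (f := fun x => (a - m) ^ 2 + 2 * (a - m) * (m - ψ x)) (g := fun x => (ψ x - m) ^ 2) hI3 h2,
    integral_add (f := fun _ => (a - m) ^ 2) (g := fun x => 2 * (a - m) * (m - ψ x)) (integrable_const _) hlin,
    integral_const_mul, integral_sub (f := fun _ => m) (g := ψ) (integrable_const m) hψi]
  simp only [integral_const, probReal_univ, smul_eq_mul, one_mul, ← hm, sub_self, mul_zero, add_zero]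

end HolleyStroock

end Summit.Ventures.YMGap.RobustBall.LangevinPoincare

end
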